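import Literature.Computability.AlgebraicComplexity.TavenasRealTauWithConstants
import Literature.Computability.AlgebraicComplexity.RealTauConjectureViaVnProofs
import Literature.Computability.AlgebraicComplexity.RealTauConjectureProofs
import Mathlib.RingTheory.MvPolynomial.Tower
import HarnessLib

/-!
# Discharge of Tavenas' transfer theorem WITH constants (`Tavenas2014_thm_3_38_holds`)

The named fact `Literature.Computability.AlgebraicComplexity.Tavenas2014_thm_3_38`
(`TavenasRealTauWithConstants.lean`; S. Tavenas, *Bornes inférieures et supérieures dans les
circuits arithmétiques*, PhD thesis, ENS Lyon 2014, Thm. 3.38, p. 54: the refined real-zero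
hypothesis of Conj. 3.23 implies that the permanent family is not p-computable over `ℝ`, circuit
constants allowed) is a THEOREM of the tree.

The printed proof (§2.2, pp. 53–54) runs, for an ARBITRARY coefficient field `K ⊇ ℚ`:

* `exists_sps_of_complexity_le` — **Prop. 3.21 with constants, for arbitrary families**: if
  `h_n ∈ K[x_0..x_{d(n)-1}, z_0..z_{r(n)-1}]` is multilinear, `r(n) ≤ d(n) ≤ (n+2)^{e₁}`,
  `L_K(h_n) ≤ (n+2)^{e₂}`, and `f_n = h_n(v_n)` for a substitution `v_n` of terms `c X^e`, then
  `f_n = ∑_{i<k} ∏_{j<m} g_{ij}` in `K[X]` with `k, t ≤ (n+2)^{C(⌊√d(n)⌋+1)}`, `m ≤ C(⌊√d(n)⌋+1)`,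
  every `g_{ij}` `t`-sparse (`C = prop321Const (e₁ + e₂ + 6)`).  This is the tree's proof of the
  constant-free twin `exists_sps_of_isProjection_perPoly` (`RealTauConjectureViaVn.lean`) with its
  single use of `τ(PER) = n^{O(1)}` replaced by the hypothesis on `complexity h_n`; every other
  ingredient (`ArithCircuit.exists_computes_size_eq_complexity`, `DepthReduction.exists_slp`,
  `DepthReduction.SLP.exists_sum_prod` = thesis Thm. 2.16, `DepthReduction.card_le_of_degree_le`,
  the arithmetic `prop321_*`) is coefficient-generic.
* `exists_liftData_tavenasV` — **Cor. 3.37 over `K` with a complexity bound**: if `PER` is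
  p-computable over `K` then the base change `h_n ⊗ K` of the multilinear polynomial of
  `Tavenas2014_cor_3_37_holds` has `L_K ≤ (n+2)^e` (projections are free,
  `IsProjection.complexity_le_holds`) and `(h_n ⊗ K)(X^{2^j}; 2^{2^i}) = V_n`.
* `exists_sps_tavenasV_of_isPBounded` — the two combined with `d = r = 2n + 3`: p-computability of
  `PER` over `K` writes every `V_n`, in `K[X]`, as a sum of Tavenas size of products of sparse
  polynomials.
* `Tavenas2014_thm_3_38_holds` — over `K = ℝ`: the refined real-zero bound
  `2^{a(m+1)} (k+t+2)^a ≤ (n+2)^{a(2C+3)(⌊√(2n+3)⌋+4)}` loses against the `2^n - 1` distinct real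
  roots of `V_n` (`le_card_roots_toFinset_map_tavenasV`, `exists_pow_sqrt_lt_two_pow`).

The same computation was carried out Summit-side for `K = ℝ` (route `RealTau` of
`ValiantsHypothesis`, items `RealVnTransfer` / `RefinedImpliesHard`); this file makes it a
Literature theorem for every field of characteristic zero and discharges the named fact.

## References

* S. Tavenas, PhD thesis, ENS Lyon 2014, Prop. 3.17, Prop. 3.21, Lemme 3.36, Cor. 3.37, Thm. 3.38.
* S. Tavenas, *Improved bounds for reduction to depth 4 and depth 3*, Inform. Comput. 240 (2015),
  Thm. 1.
* P. Bürgisser, *Completeness and Reduction in Algebraic Complexity Theory*, Springer 2000,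
  Rem. 2.7 (projections are free).
-/

noncomputable section

open MvPolynomial

namespace Literature.Computability.AlgebraicComplexity

/-! ### Base change of projections and of the substitution (3.1) -/

/-- Projections are preserved by a change of coefficients: if `g = f(a)` with every `a i` a
variable or a constant, then `φ g = (φ f)(φ a)` with `φ (X j) = X j`, `φ (C c) = C (φ c)`
(Bürgisser 2000, §4.1). [cite: Burgisser2000, §4.1] -/
theorem IsProjection.map {k k' : Type*} [CommSemiring k] [CommSemiring k'] {σ τ : Type*}
    (φ : k →+* k') {g : MvPolynomial τ k} {f : MvPolynomial σ k} (hg : IsProjection g f) :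
    IsProjection (MvPolynomial.map φ g) (MvPolynomial.map φ f) := by
  obtain ⟨a, ha, rfl⟩ := hg
  refine ⟨fun i => MvPolynomial.map φ (a i), fun i => ?_, ?_⟩
  · rcases ha i with ⟨j, hj⟩ | ⟨c, hc⟩
    · exact Or.inl ⟨j, by simp only [hj, map_X]⟩
    · exact Or.inr ⟨φ c, by simp only [hc, map_C]⟩
  · rw [aeval_eq_bind₁, aeval_eq_bind₁]
    exact map_bind₁ φ a f

/-- Terms `c X^e` stay terms under a change of coefficients (used for the substitution (3.1) of
the proof of Prop. 3.17 after base change). [cite: Tavenas2014, proof of Prop. 3.21] -/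
theorem IsTerm.map {R S : Type*} [CommSemiring R] [CommSemiring S] (φ : R →+* S)
    {p : Polynomial R} (hp : IsTerm p) : IsTerm (p.map φ) := by
  obtain ⟨c, e, rfl⟩ := hp
  exact ⟨φ c, e, by simp only [Polynomial.map_mul, Polynomial.map_C, Polynomial.map_pow,
    Polynomial.map_X]⟩

/-- Every value of the substitution (3.1), base-changed to `K`, is a term `c X^e`.
[cite: Tavenas2014, proof of Prop. 3.17, (3.1)] -/
theorem isTerm_map_kpSubst {K : Type*} [Field K] [CharZero K] (d r : ℕ) (x : Fin d ⊕ Fin r) :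
    IsTerm ((kpSubst d r x).map (algebraMap ℚ K)) :=
  (isTerm_kpSubst d r x).map _

/-- **The substitution (3.1) commutes with base change `ℚ → K`**: for `h ∈ ℚ[x, z]`,
`(h ⊗ K)(X^{2^j} ⊗ K; 2^{2^i}) = h(X^{2^j}; 2^{2^i}) ⊗ K` in `K[X]`. [cite: Tavenas2014, Cor. 3.37] -/
theorem aeval_map_kpSubst_map {K : Type*} [Field K] [CharZero K] {d r : ℕ}
    (h : MvPolynomial (Fin d ⊕ Fin r) ℚ) :
    MvPolynomial.aeval (fun x => (kpSubst d r x).map (algebraMap ℚ K))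
        (MvPolynomial.map (algebraMap ℚ K) h) =
      (MvPolynomial.aeval (kpSubst d r) h).map (algebraMap ℚ K) := by
  rw [MvPolynomial.aeval_map_algebraMap, ← Polynomial.mapAlg_eq_map,
    MvPolynomial.comp_aeval_apply]
  rfl

/-! ### Prop. 3.21 with constants, for arbitrary families -/

/-- **Tavenas' Prop. 3.21 WITH CONSTANTS, over any commutative semiring `K`, for arbitrary
families** (thesis 2014, proof of Prop. 3.21 p. 47 with `L_K` in place of `τ`; Thm. 2.16 = the
tree's `DepthReduction.SLP.exists_sum_prod`): if `h_n ∈ K[x_0..x_{d(n)-1}, z_0..z_{r(n)-1}]` is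
multilinear, `r(n) ≤ d(n) ≤ (n+2)^{e₁}`, `L_K(h_n) ≤ (n+2)^{e₂}`, and `f_n = h_n(v_n)` for a
substitution `v_n` of TERMS `c X^e`, then `f_n = ∑_{i<k} ∏_{j<m} g_{ij}` in `K[X]` with
`k, t ≤ (n+2)^{C(⌊√d(n)⌋+1)}`, `m ≤ C(⌊√d(n)⌋+1)`, every `g_{ij}` `t`-sparse.  The proof of
`exists_sps_of_isProjection_perPoly`, verbatim, with its step `hsle` as the hypothesis.
[cite: Tavenas2014, Prop. 3.21 and Thm. 2.16] -/
theorem exists_sps_of_complexity_le {K : Type*} [CommSemiring K]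
    (f : ℕ → Polynomial K) (d r : ℕ → ℕ) (e₁ e₂ : ℕ)
    (he₁ : ∀ n, d n ≤ (n + 2) ^ e₁) (hrd : ∀ n, r n ≤ d n)
    (v : ∀ n, Fin (d n) ⊕ Fin (r n) → Polynomial K) (hv : ∀ n x, IsTerm (v n x))
    (H : ∀ n, ∃ h : MvPolynomial (Fin (d n) ⊕ Fin (r n)) K,
      complexity h ≤ (n + 2) ^ e₂ ∧ (∀ m ∈ h.support, ∀ x, m x ≤ 1) ∧
        MvPolynomial.aeval (v n) h = f n) :
    ∃ C : ℕ, ∀ n, ∃ (k m t : ℕ) (g : Fin k → Fin m → Polynomial K),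
      k ≤ (n + 2) ^ (C * (Nat.sqrt (d n) + 1)) ∧
      m ≤ C * (Nat.sqrt (d n) + 1) ∧
      t ≤ (n + 2) ^ (C * (Nat.sqrt (d n) + 1)) ∧
      (∀ i j, (g i j).support.card ≤ t) ∧
      (∑ i, ∏ j, g i j) = f n := by
  classical
  refine ⟨prop321Const (e₁ + e₂ + 6), fun n => ?_⟩
  obtain ⟨h, hcx, hml, hsub⟩ := H n
  have hB2 : 2 ≤ n + 2 := by omega
  have hD1 : 1 ≤ Nat.sqrt (d n) + 1 := Nat.succ_pos _
  have hu1 : 1 ≤ Nat.sqrt (d n + r n) + 1 := Nat.succ_pos _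
  have hδd : d n + r n ≤ 2 * d n := by have := hrd n; omega
  have huD : Nat.sqrt (d n + r n) + 1 ≤ 2 * (Nat.sqrt (d n) + 1) := sqrt_add_one_le hδd
  have hRle : 8 * (d n + r n) / (Nat.sqrt (d n + r n) + 1 + 1) ≤ 16 * (Nat.sqrt (d n) + 1) :=
    (rounds_le _).trans (by omega)
  -- size of a minimal circuit for `h` (an opaque name `s`, so that no tactic unfolds `complexity`)
  obtain ⟨s, hs⟩ : ∃ s : ℕ, complexity h = s := ⟨_, rfl⟩
  have hsle : s ≤ (n + 2) ^ e₂ := by rw [← hs]; exact hcx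
  -- the exponent
  obtain ⟨hδ1, hsE, hu1', hδu⟩ := prop321_exponent hB2 (he₁ n) (hrd n) hsle
  -- the sparsity bound of a polynomial of degree `≤ u` in `δ` variables under the term substitution
  have hsparse : ∀ p : MvPolynomial (Fin (d n) ⊕ Fin (r n)) K,
      p.totalDegree ≤ Nat.sqrt (d n + r n) + 1 →
      (MvPolynomial.aeval (v n) p).support.card ≤
        (n + 2) ^ (prop321Const (e₁ + e₂ + 6) * (Nat.sqrt (d n) + 1)) := by
    intro p hp
    calc (MvPolynomial.aeval (v n) p).support.card ≤ p.support.card :=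
          card_support_aeval_le_of_isTerm (hv n) p
      _ ≤ (Nat.sqrt (d n + r n) + 1 + 1) *
            (Fintype.card (Fin (d n) ⊕ Fin (r n)) + (Nat.sqrt (d n + r n) + 1)) ^
              (Nat.sqrt (d n + r n) + 1) :=
          DepthReduction.card_le_of_degree_le _ hu1 fun m hm => (le_totalDegree hm).trans hp
      _ = (Nat.sqrt (d n + r n) + 1 + 1) *
            (d n + r n + (Nat.sqrt (d n + r n) + 1)) ^ (Nat.sqrt (d n + r n) + 1) := by
          rw [Fintype.card_sum, Fintype.card_fin, Fintype.card_fin]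
      _ ≤ (n + 2) ^ (prop321Const (e₁ + e₂ + 6) * (Nat.sqrt (d n) + 1)) :=
          prop321_tBound hB2 hD1 hu1' hδu huD
  have hfmap : f n = MvPolynomial.aeval (v n) h := hsub.symm
  -- a minimal circuit for `h` and its straight-line program
  obtain ⟨P, hP1, hP2, hP3⟩ := ArithCircuit.exists_computes_size_eq_complexity h
  obtain ⟨S, hSlen, hcases⟩ := DepthReduction.exists_slp P hP1
  rw [show P.eval = h from hP2] at hcases
  rw [hs] at hP3
  rcases hcases with ⟨i, hi, hval⟩ | htriv
  · -- main case: `h` is a value of the straight-line program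
    have hdegh : (S.val i).totalDegree ≤ d n + r n := by
      rw [← hval]
      have := totalDegree_le_card_of_multilinear hml
      rwa [Fintype.card_sum, Fintype.card_fin, Fintype.card_fin] at this
    obtain ⟨L, hLsum, hLlen, hLT⟩ :=
      S.exists_sum_prod (d n + r n) (t := Nat.sqrt (d n + r n) + 1) hu1 hi hdegh
    rw [hSlen, hP3] at hLlen
    refine ⟨L.length, 1 + 4 * (8 * (d n + r n) / (Nat.sqrt (d n + r n) + 1 + 1)),
      (n + 2) ^ (prop321Const (e₁ + e₂ + 6) * (Nat.sqrt (d n) + 1)),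
      fun i j => MvPolynomial.aeval (v n) ((L[i.val]).getD j.val 1),
      hLlen.trans (prop321_kBound hB2 hD1 hδ1 hsE hRle), prop321_mBound hD1 hRle, le_rfl, ?_, ?_⟩
    · -- sparsity of the factors
      intro i j
      apply hsparse
      rcases DepthReduction.getD_one_mem_or (L[i.val]) j.val with hmem | hone
      · exact (hLT _ (List.getElem_mem _)).2 _ hmem
      · rw [hone, totalDegree_one]; exact Nat.zero_le _
    · -- the identity `∑ ∏ g i j = f_n`
      rw [hfmap, hval, ← hLsum]
      have hprod : ∀ i : Fin L.length,
          ∏ j : Fin (1 + 4 * (8 * (d n + r n) / (Nat.sqrt (d n + r n) + 1 + 1))),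
              MvPolynomial.aeval (v n) ((L[i.val]).getD j.val 1) =
            MvPolynomial.aeval (v n) (L[i.val]).prod := fun i => by
        rw [← map_prod, DepthReduction.prod_getD_one _ _ (hLT _ (List.getElem_mem _)).1]
      simp only [hprod]
      rw [map_list_sum, List.map_map]
      exact Fin.sum_univ_fun_getElem L (fun l => MvPolynomial.aeval (v n) l.prod)
  · -- degenerate case: `h` is a variable or a constant, a single term
    have hterm : IsTerm (MvPolynomial.aeval (v n) h) := by
      rcases htriv with ⟨j, hj⟩ | ⟨c, hc⟩
      · rw [hj, MvPolynomial.aeval_X]; exact hv n j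
      · rw [hc, MvPolynomial.aeval_C, Polynomial.algebraMap_eq]; exact isTerm_C c
    have h1 : 1 ≤ (n + 2) ^ (prop321Const (e₁ + e₂ + 6) * (Nat.sqrt (d n) + 1)) :=
      Nat.one_le_pow _ _ (by omega)
    refine ⟨1, 1, 1, fun _ _ => MvPolynomial.aeval (v n) h, h1,
      one_le_prop321Const_mul hD1, h1, fun _ _ => hterm.card_support_le, ?_⟩
    rw [hfmap]; simp

/-! ### Cor. 3.37 over `K`, with a complexity bound -/

/-- **LIFT DATA — Cor. 3.37 over a field `K` of characteristic zero, with a complexity bound**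
(thesis 2014, Cor. 3.37 p. 54 and the first lines of the proof of Prop. 3.21: "`D_n` est une
projection de `C_{q(n)}`"): if `PER` is p-computable over `K` then for some `e` and every `n`
there is a multilinear `H_n ∈ K[x_0..x_{2n+2}, z_0..z_{2n+2}]` with `L_K(H_n) ≤ (n+2)^e` and
`H_n(X^{2^j}; 2^{2^i}) = V_n` in `K[X]` — namely `H_n = h_n ⊗ K` for the tree's
`Tavenas2014_cor_3_37_holds` (`IsProjection.map`, `map_perPoly`,
`IsProjection.complexity_le_holds`, `IsPBounded.comp_holds`, `support_map_subset`,
`aeval_map_kpSubst_map`). [cite: Tavenas2014, Cor. 3.37; Burgisser2000, Rem. 2.7] -/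
theorem exists_liftData_tavenasV {K : Type} [Field K] [CharZero K]
    (hK : IsPBounded fun n => complexity (perPoly (Fin n) K)) :
    ∃ e : ℕ, ∀ n, ∃ H : MvPolynomial (Fin (2 * n + 3) ⊕ Fin (2 * n + 3)) K,
      complexity H ≤ (n + 2) ^ e ∧ (∀ m ∈ H.support, ∀ x, m x ≤ 1) ∧
        MvPolynomial.aeval (fun x => (kpSubst (2 * n + 3) (2 * n + 3) x).map (algebraMap ℚ K)) H =
          (tavenasV n).map (Int.castRingHom K) := by
  -- Tavenas' family over `ℚ` and the `K`-complexity of the permanent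
  obtain ⟨q, hq, Hh⟩ := Tavenas2014_cor_3_37_holds
  obtain ⟨e₁, he₁⟩ :=
    (IsPBounded.comp_holds (s := fun n => complexity (perPoly (Fin n) K)) hK hq).exists_le_pow
  refine ⟨e₁, fun n => ?_⟩
  obtain ⟨h, hproj, hml, hsub⟩ := Hh n
  refine ⟨MvPolynomial.map (algebraMap ℚ K) h, ?_, fun m hm x => ?_, ?_⟩
  · -- projections with rational constants are free for `complexity`
    have hp : IsProjection (MvPolynomial.map (algebraMap ℚ K) h) (perPoly (Fin (q n)) K) := by
      have := hproj.map (algebraMap ℚ K)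
      rwa [map_perPoly] at this
    exact (IsProjection.complexity_le_holds hp).trans (he₁ n)
  · -- multilinearity survives the base change
    exact hml m (support_map_subset _ _ hm) x
  · -- the substitution identity, mapped along `ℚ → K`
    rw [aeval_map_kpSubst_map, hsub, Polynomial.map_map,
      RingHom.ext_int ((algebraMap ℚ K).comp (Int.castRingHom ℚ)) (Int.castRingHom K)]

/-- **`V_n` has sparse `ΣΠ` expressions of Tavenas size if `PER` is p-computable over `K`**
(thesis 2014, §2.2: Cor. 3.37 + Prop. 3.21 with constants): for a field `K` of characteristic
zero, if `L_K(PER_n)` is p-bounded then for some `C` every `V_n` equals, in `K[X]`, a sum of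
`k ≤ (n+2)^{C(⌊√(2n+3)⌋+1)}` products of `m ≤ C(⌊√(2n+3)⌋+1)` polynomials with at most
`t ≤ (n+2)^{C(⌊√(2n+3)⌋+1)}` monomials each. [cite: Tavenas2014, Cor. 3.37 and Prop. 3.21] -/
theorem exists_sps_tavenasV_of_isPBounded {K : Type} [Field K] [CharZero K]
    (hK : IsPBounded fun n => complexity (perPoly (Fin n) K)) :
    ∃ C : ℕ, ∀ n, ∃ (k m t : ℕ) (g : Fin k → Fin m → Polynomial K),
      k ≤ (n + 2) ^ (C * (Nat.sqrt (2 * n + 3) + 1)) ∧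
      m ≤ C * (Nat.sqrt (2 * n + 3) + 1) ∧
      t ≤ (n + 2) ^ (C * (Nat.sqrt (2 * n + 3) + 1)) ∧
      (∀ i j, (g i j).support.card ≤ t) ∧
      (∑ i, ∏ j, g i j) = (tavenasV n).map (Int.castRingHom K) := by
  obtain ⟨e, He⟩ := exists_liftData_tavenasV hK
  have hd : ∀ n : ℕ, 2 * n + 3 ≤ (n + 2) ^ 2 := fun n => by rw [pow_two]; nlinarith
  exact exists_sps_of_complexity_le (fun n => (tavenasV n).map (Int.castRingHom K))
    (fun n => 2 * n + 3) (fun n => 2 * n + 3) 2 e hd (fun n => le_rfl)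
    (fun n x => (kpSubst (2 * n + 3) (2 * n + 3) x).map (algebraMap ℚ K))
    (fun n x => isTerm_map_kpSubst _ _ x) He

/-! ### Theorem 3.38 -/

/-- **Tavenas' transfer theorem with constants** (discharge of the named fact
`Tavenas2014_thm_3_38`; thesis 2014, Thm. 3.38, p. 54): the refined real-zero hypothesis
(Conj. 3.23: a nonzero `∑_{i<k} ∏_{j<m} f_ij` with `t`-sparse real `f_ij` has at most
`2^{a(m+1)} (k+t+2)^a` distinct real zeros) implies that the permanent family is not p-computable
over `ℝ`.  Proof: under p-computability, `exists_sps_tavenasV_of_isPBounded` (`K = ℝ`) writes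
every `V_n` as such a sum with `k, t ≤ (n+2)^{C(s+1)}`, `m ≤ C(s+1)`, `s = ⌊√(2n+3)⌋`; the
hypothesis bounds its `2^n - 1` distinct real roots (`le_card_roots_toFinset_map_tavenasV`) by
`2^{a(m+1)} (k+t+2)^a ≤ (n+2)^{a(2C+3)(s+4)}`, false for the `n` of `exists_pow_sqrt_lt_two_pow`.
[cite: Tavenas2014, Thm. 3.38 (p. 54)] -/
theorem Tavenas2014_thm_3_38_holds : Tavenas2014_thm_3_38 := by
  rintro ⟨a, ha⟩ hP
  obtain ⟨C, hC⟩ := exists_sps_tavenasV_of_isPBounded (K := ℝ) hP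
  -- the bad `n`
  set A : ℕ := a * (2 * C + 3) + 1 with hA
  obtain ⟨n, hn⟩ := exists_pow_sqrt_lt_two_pow A
  obtain ⟨k, m, t, g, hk, hm, ht, hg, hsum⟩ := hC n
  have hne : (∑ i, ∏ j, g i j) ≠ 0 := by
    rw [hsum]; exact map_tavenasV_ne_zero _
  have hroots := ha k m t g hg hne
  rw [hsum] at hroots
  -- `2^n - 1 ≤ Z_ℝ(V_n) ≤ 2^{a(m+1)} (k+t+2)^a` (all roots of `V_n` are real: Hutchinson/Kurtz)
  replace hroots := (le_card_roots_toFinset_map_tavenasV n).trans hroots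
  -- bookkeeping: `2^{a(m+1)} (k+t+2)^a ≤ (n+2)^{a(2C+3)(s+4)}`, `s = ⌊√(2n+3)⌋`
  set s : ℕ := Nat.sqrt (2 * n + 3) with hs
  set E : ℕ := C * (s + 1) with hE
  have hB : 2 ≤ n + 2 := by omega
  have hB1 : 1 ≤ (n + 2) ^ E := Nat.one_le_pow _ _ (by omega)
  have h2pow : 2 ^ (a * (m + 1)) ≤ (n + 2) ^ (a * (E + 1)) :=
    calc 2 ^ (a * (m + 1)) ≤ (n + 2) ^ (a * (m + 1)) := Nat.pow_le_pow_left hB _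
      _ ≤ (n + 2) ^ (a * (E + 1)) :=
          Nat.pow_le_pow_right (by omega) (Nat.mul_le_mul_left a (by omega))
  have hkt : k + t + 2 ≤ (n + 2) ^ (E + 2) := by
    have h4 : 4 ≤ (n + 2) ^ 2 :=
      calc 4 = 2 ^ 2 := by norm_num
        _ ≤ (n + 2) ^ 2 := Nat.pow_le_pow_left hB 2
    calc k + t + 2 ≤ 4 * (n + 2) ^ E := by omega
      _ ≤ (n + 2) ^ 2 * (n + 2) ^ E := Nat.mul_le_mul_right _ h4
      _ = (n + 2) ^ (E + 2) := by rw [← pow_add, Nat.add_comm 2 E]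
  have hkta : (k + t + 2) ^ a ≤ (n + 2) ^ (a * (E + 2)) :=
    calc (k + t + 2) ^ a ≤ ((n + 2) ^ (E + 2)) ^ a := Nat.pow_le_pow_left hkt a
      _ = (n + 2) ^ (a * (E + 2)) := by rw [← pow_mul, mul_comm]
  have hexp : a * (E + 1) + a * (E + 2) ≤ a * (2 * C + 3) * (s + 4) := by
    have : (E + 1) + (E + 2) ≤ (2 * C + 3) * (s + 4) := by rw [hE]; nlinarith
    calc a * (E + 1) + a * (E + 2) = a * ((E + 1) + (E + 2)) := by ring
      _ ≤ a * ((2 * C + 3) * (s + 4)) := Nat.mul_le_mul_left a this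
      _ = a * (2 * C + 3) * (s + 4) := by ring
  have key : 2 ^ n - 1 ≤ (n + 2) ^ (a * (2 * C + 3) * (s + 4)) :=
    calc 2 ^ n - 1 ≤ 2 ^ (a * (m + 1)) * (k + t + 2) ^ a := hroots
      _ ≤ (n + 2) ^ (a * (E + 1)) * (n + 2) ^ (a * (E + 2)) := Nat.mul_le_mul h2pow hkta
      _ = (n + 2) ^ (a * (E + 1) + a * (E + 2)) := by rw [← pow_add]
      _ ≤ (n + 2) ^ (a * (2 * C + 3) * (s + 4)) := Nat.pow_le_pow_right (by omega) hexp
  -- the extra factor `(n + 2)^{s + 4} ≥ 2` in `hn` absorbs the `- 1`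
  have hsplit : (n + 2) ^ (A * (s + 4)) =
      (n + 2) ^ (a * (2 * C + 3) * (s + 4)) * (n + 2) ^ (s + 4) := by
    rw [← pow_add]; congr 1; rw [hA]; ring
  have h2le : 2 ≤ (n + 2) ^ (s + 4) :=
    calc 2 ≤ n + 2 := hB
      _ ≤ (n + 2) ^ (s + 4) := Nat.le_self_pow (by omega) _
  have hLY : 2 * (n + 2) ^ (a * (2 * C + 3) * (s + 4)) ≤ (n + 2) ^ (A * (s + 4)) := by
    rw [hsplit, mul_comm]
    exact Nat.mul_le_mul_left _ h2le
  have h1P : 1 ≤ 2 ^ n := Nat.one_le_two_pow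
  have h1Y : 1 ≤ (n + 2) ^ (a * (2 * C + 3) * (s + 4)) := Nat.one_le_pow _ _ (by omega)
  have h1L : 1 ≤ (n + 2) ^ (A * (s + 4)) := Nat.one_le_pow _ _ (by omega)
  omega

end Literature.Computability.AlgebraicComplexity
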